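import Literature.Analysis.FunctionSpaces.PV1Skolem
import HarnessLib

/-!
# Models of `PV₁`: the error finder, the universal theory of `PV₁`, Herbrand-saturated models

Fourth layer of the toolkit for `S2PV_one_isConservativeOver_PV1` (Buss 1986, Ch. 6;
Krajíček 1995, §5.3, Thm. 7.6.3; Avigad 2002, §§3–4).

* **The error finder** (`PV1.cex_spec`): in every model of `PV₁`, Krajíček's counterexample
  search `cex Gd (ȳ, x)` (`PVTables.lean`) finds, whenever `Gd(ȳ, 0) ≠ 0` and `Gd(ȳ, x) = 0`,
  a point `c ≠ 0` with `Gd(ȳ, ⌊c/2⌋) ≠ 0` and `Gd(ȳ, c) = 0` — proved by open `PIND`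
  (Krajíček 1995, §5.3: the binary-search / counterexample functions by which the open
  induction of `PV₁` is a universal theory; Cook 1975, §2);
* consequently every instance of open `PIND` is, over `PV₁`, equivalent to a **universal
  sentence** `errorSentence ψ` true in all models of `PV₁` (`PV1.realize_errorFormula`);
* `univPV1`, the set of universal consequences of `PV₁`, and the two facts that make the
  Herbrand-saturation route work for the *axiomatised* theory `PV₁` (not just for the true
  theory of `ℕ`): a model of `PV₁` is a model of `univPV1` (soundness), and **a model of
  `univPV1` is a model of `PV₁`** (`model_PV1_of_model_univPV1`: `PVdef` and `BASIC` are
  universal, and open `PIND` follows from the error sentences);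
* **every model of `PV₁` maps, preserving all universal formulas with parameters, into an
  Herbrand-saturated model of `PV₁`** (`exists_herbrandSaturated_model_PV1`; Avigad 2002,
  Thm. 3.2 via `exists_preservesUniversal_isHerbrandSaturated`).

## References

* J. Avigad, *Saturated models of universal theories*, APAL 118 (2002), Thms. 3.2–3.4, §4.
* J. Krajíček, *Bounded Arithmetic, Propositional Logic and Complexity Theory*, CUP 1995, §5.3
  (Def. 5.3.1 and the universal axiomatisation of `PV₁`), Thm. 7.6.3.
* S. A. Cook, *Feasibly constructive proofs and the propositional calculus*, STOC 1975, §2–3.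
-/

namespace Literature.Analysis.FunctionSpaces

open FirstOrder FirstOrder.Language FirstOrder.Language.BoundedFormula
open Literature.Computability.MetaComplexity Literature.Computability.MetaComplexity.BASICModel
open Literature.ModelTheory.UniversalTheories

attribute [local instance] pvReduct isExpansionOn_pvReduct

namespace PV1

variable {M : Type} [Language.pv.Structure M]

/-! ## The counterexample search in a model of `PV₁` -/

section Cex

open PVFun

variable {p : ℕ}

/-- `appWith F t (ȳ, y, r) = F(ȳ, t(ȳ, y, r))` in a model of `PVdef`. [folklore] -/
theorem papp_appWith (hD : M ⊨ PVdef) (F : PVFun (p + 1)) (t : PVFun (p + 2)) (ys : Fin p → M)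
    (a r : M) :
    papp (appWith F t) (Fin.snoc (Fin.snoc ys a) r) =
      papp F (Fin.snoc ys (papp t (Fin.snoc (Fin.snoc ys a) r))) := by
  rw [appWith, papp_comp hD]; congr 1; funext i
  cases i using Fin.lastCases with
  | last => simp
  | cast i => simp [papp_proj hD]

/-- `appLast F t (ȳ) = F(ȳ, t ȳ)` in a model of `PVdef`. [folklore] -/
theorem papp_appLast (hD : M ⊨ PVdef) (F : PVFun (p + 1)) (t : PVFun p) (ys : Fin p → M) :
    papp (appLast F t) ys = papp F (Fin.snoc ys (papp t ys)) := by
  rw [appLast, papp_comp hD]; congr 1; funext i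
  cases i using Fin.lastCases with
  | last => simp
  | cast i => simp [papp_proj hD]

/-- `yv (ȳ, y, r) = y`. [folklore] -/
@[simp] theorem papp_yv (hD : M ⊨ PVdef) (ys : Fin p → M) (a r : M) :
    papp (yv : PVFun (p + 2)) (Fin.snoc (Fin.snoc ys a) r) = a := by
  rw [yv, papp_proj hD]; simp

/-- `rv (ȳ, y, r) = r`. [folklore] -/
@[simp] theorem papp_rv (hD : M ⊨ PVdef) (ys : Fin p → M) (a r : M) :
    papp (rv : PVFun (p + 2)) (Fin.snoc (Fin.snoc ys a) r) = r := by
  rw [rv, papp_proj hD]; simp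

/-- `lastv (ȳ, a) = a`. [folklore] -/
@[simp] theorem papp_lastv (hD : M ⊨ PVdef) (ys : Fin p → M) (a : M) :
    papp (lastv : PVFun (p + 1)) (Fin.snoc ys a) = a := by
  rw [lastv, papp_proj hD]; simp

variable [hB : M ⊨ BASIC]

/-- `cex Gd (ȳ, x) ≤ x`. [cite: Krajicek1995, §5.3] -/
theorem cex_le (hD : M ⊨ PVdef) (Gd : PVFun (p + 1)) (ys : Fin p → M) (x : M) :
    papp (cex Gd) (Fin.snoc ys x) ≤ x := by
  have h := papp_limRec_le hD zero'
    (fun j => ap₃ cond rv (ap₃ cond (appWith Gd yv) zero'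
      (ap₃ cond (appWith Gd (ap₁ (bit j) yv)) (ap₁ (bit j) yv) zero')) rv) lastv ys x
  rwa [papp_lastv hD] at h

/-- `cex Gd (ȳ, 0) = 0`. [cite: Krajicek1995, §5.3] -/
theorem cex_zero (hD : M ⊨ PVdef) (Gd : PVFun (p + 1)) (ys : Fin p → M) :
    papp (cex Gd) (Fin.snoc ys 0) = 0 :=
  le_antisymm (cex_le hD Gd ys 0) bot_le

/-- The step of `cex`: for `s_j y ≠ 0`, with `r = cex Gd (ȳ, y)`,
`cex Gd (ȳ, s_j y) = cond (r, cond (Gd(ȳ,y), 0, cond (Gd(ȳ,s_j y), s_j y, 0)), r)`.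
[cite: Krajicek1995, §5.3] -/
theorem cex_pbit (hD : M ⊨ PVdef) (Gd : PVFun (p + 1)) (ys : Fin p → M) {j : Bool} {y : M}
    (hy : pbit j y ≠ 0) :
    papp (cex Gd) (Fin.snoc ys (pbit j y)) =
      pcond (papp (cex Gd) (Fin.snoc ys y))
        (pcond (papp Gd (Fin.snoc ys y)) 0 (pcond (papp Gd (Fin.snoc ys (pbit j y))) (pbit j y) 0))
        (papp (cex Gd) (Fin.snoc ys y)) := by
  have h := papp_limRec_bit hD j zero'
    (fun j => ap₃ cond rv (ap₃ cond (appWith Gd yv) zero'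
      (ap₃ cond (appWith Gd (ap₁ (bit j) yv)) (ap₁ (bit j) yv) zero')) rv) lastv ys y hy
  rw [papp_lastv hD] at h
  rw [cex, h, ← cex]
  simp only [papp_ap₃ hD, papp_ap₁ hD, papp_rv hD, papp_yv hD, papp_appWith hD, papp_zero' hD]
  refine min_eq_left ?_
  set r := papp (cex Gd) (Fin.snoc ys y)
  have hr : r ≤ pbit j y := (cex_le hD Gd ys y).trans (le_pbit hD j y)
  show pcond r (pcond _ 0 (pcond _ (pbit j y) 0)) r ≤ pbit j y
  rcases pcond_eq_or hD r (pcond (papp Gd (Fin.snoc ys y)) 0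
    (pcond (papp Gd (Fin.snoc ys (papp (bit j) ![y]))) (pbit j y) 0)) r with e | e <;> rw [e]
  · rcases pcond_eq_or hD (papp Gd (Fin.snoc ys y)) 0
      (pcond (papp Gd (Fin.snoc ys (papp (bit j) ![y]))) (pbit j y) 0) with e' | e' <;> rw [e']
    · exact bot_le
    · rcases pcond_eq_or hD (papp Gd (Fin.snoc ys (papp (bit j) ![y]))) (pbit j y) 0 with
        e'' | e'' <;> rw [e'']
      exact bot_le
  · exact hr

/-- **Specification of the counterexample search in every model of `PV₁`.** Writing
`C = cex Gd (ȳ, x)`: if `C ≠ 0` then `Gd(ȳ, C) = 0` and `Gd(ȳ, ⌊C/2⌋) ≠ 0`; if `C = 0` and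
`Gd(ȳ, 0) ≠ 0` then `Gd(ȳ, x) ≠ 0` (open `PIND` on `x`). [cite: Krajicek1995, §5.3] -/
theorem cex_spec (hM : M ⊨ PV1) (Gd : PVFun (p + 1)) (ys : Fin p → M) (x : M) :
    (papp (cex Gd) (Fin.snoc ys x) ≠ 0 →
      papp Gd (Fin.snoc ys (papp (cex Gd) (Fin.snoc ys x))) = 0 ∧
      papp Gd (Fin.snoc ys (mHalf (papp (cex Gd) (Fin.snoc ys x)))) ≠ 0) ∧
    (papp (cex Gd) (Fin.snoc ys x) = 0 → papp Gd (Fin.snoc ys 0) ≠ 0 →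
      papp Gd (Fin.snoc ys x) ≠ 0) := by
  have hD := model_PVdef_of_model_PV1 hM
  refine IsQFPVDef.bitInd hM
    (P := fun x => (papp (cex Gd) (Fin.snoc ys x) ≠ 0 →
      papp Gd (Fin.snoc ys (papp (cex Gd) (Fin.snoc ys x))) = 0 ∧
      papp Gd (Fin.snoc ys (mHalf (papp (cex Gd) (Fin.snoc ys x)))) ≠ 0) ∧
    (papp (cex Gd) (Fin.snoc ys x) = 0 → papp Gd (Fin.snoc ys 0) ≠ 0 →
      papp Gd (Fin.snoc ys x) ≠ 0)) ?_ ?_ ?_ x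
  · have hC : IsPVTermFn fun v : Fin 1 → M => papp (cex Gd) (Fin.snoc ys (v 0)) :=
      isPVTermFn_app_snoc1 _ ys isPVTermFn_v0
    refine IsQFPVDef.and (IsQFPVDef.imp (IsQFPVDef.ne' hC IsPVTermFn.zero)
      (IsQFPVDef.and (IsQFPVDef.eq (isPVTermFn_app_snoc1 _ ys hC) IsPVTermFn.zero)
        (IsQFPVDef.ne' (isPVTermFn_app_snoc1 _ ys hC.half) IsPVTermFn.zero)))
      (IsQFPVDef.imp (IsQFPVDef.eq hC IsPVTermFn.zero) (IsQFPVDef.imp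
        (IsQFPVDef.ne' (isPVTermFn_app_snoc1 _ ys IsPVTermFn.zero) IsPVTermFn.zero)
        (IsQFPVDef.ne' (isPVTermFn_app_snoc1 _ ys isPVTermFn_v0) IsPVTermFn.zero)))
  · refine ⟨fun h => absurd (cex_zero hD Gd ys) h, fun _ h => h⟩
  · rintro j y hy ⟨ih1, ih2⟩
    rw [cex_pbit hD Gd ys hy]
    set r := papp (cex Gd) (Fin.snoc ys y) with hr
    by_cases hr0 : r = 0
    · rw [hr0, pcond_zero hD]
      by_cases hG : papp Gd (Fin.snoc ys y) = 0
      · rw [hG, pcond_zero hD]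
        exact ⟨fun h => absurd rfl h, fun _ h0 => absurd hG (ih2 hr0 h0)⟩
      · rw [pcond_of_ne_zero hD hG]
        by_cases hG' : papp Gd (Fin.snoc ys (pbit j y)) = 0
        · rw [hG', pcond_zero hD]
          refine ⟨fun _ => ⟨hG', ?_⟩, fun h => absurd h hy⟩
          rwa [mHalf_pbit hD]
        · rw [pcond_of_ne_zero hD hG']
          exact ⟨fun h => absurd rfl h, fun _ _ => hG'⟩
    · rw [pcond_of_ne_zero hD hr0]
      exact ⟨fun _ => ih1 hr0, fun h => absurd h hr0⟩

end Cex

/-! ## Open `PIND` as universal sentences -/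

section ErrorSentence

variable {k : ℕ}

/-- The characteristic symbol of a formula with variables `Fin (k + 1)`: the characteristic term
`charTerm ψ` read as a `PV` symbol (`termSym`). [cite: Krajicek1995, §5.3] -/
def charSymFin (ψ : Language.pv.Formula (Fin (k + 1))) : PVFun (k + 1) :=
  termSym ((charTerm ψ).relabel (Sum.elim id Fin.elim0))

/-- The counterexample term `C_ψ(p̄, x) := cex χ_ψ (p̄, x)`. [cite: Krajicek1995, §5.3] -/
def cexTerm (ψ : Language.pv.Formula (Fin (k + 1))) : Language.pv.Term (Fin (k + 1)) :=
  Term.func (PVFun.cex (charSymFin ψ)) Term.var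

/-- **The error formula of an open formula `ψ(p̄, x)`**: with `C = C_ψ(p̄, x)`,
`(C ≠ 0 → ¬ψ(p̄, C) ∧ ψ(p̄, ⌊C/2⌋)) ∧ (C = 0 → ψ(p̄, 0) → ψ(p̄, x))` — the open statement which,
universally closed, replaces the `PIND` axiom of `ψ` (Krajíček 1995, §5.3: `PV₁` is axiomatised
by universal sentences about the counterexample functions). [cite: Krajicek1995, §5.3] -/
def errorFormula (ψ : Language.pv.Formula (Fin (k + 1))) : Language.pv.Formula (Fin (k + 1)) :=
  (∼(Term.equal (cexTerm ψ) 0) ⟹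
      (∼(substLast ψ (cexTerm ψ)) ⊓ substLast ψ (pvHalf (cexTerm ψ)))) ⊓
    (Term.equal (cexTerm ψ) 0 ⟹ (substLast ψ 0 ⟹ ψ))

/-- The error sentence `∀ p̄ x errorFormula ψ`. [cite: Krajicek1995, §5.3] -/
def errorSentence (ψ : Language.pv.Formula (Fin (k + 1))) : Language.pv.Sentence :=
  closeFin (errorFormula ψ)

/-- The error formula of an open formula is open. [folklore] -/
theorem isQF_errorFormula {ψ : Language.pv.Formula (Fin (k + 1))} (hψ : ψ.IsQF) :
    (errorFormula ψ).IsQF :=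
  (((IsAtomic.equal _ _).isQF.not).imp ((isQF_subst hψ _).not.inf (isQF_subst hψ _))).inf
    ((IsAtomic.equal _ _).isQF.imp ((isQF_subst hψ _).imp hψ))

/-- The error sentence of an open formula is universal. [folklore] -/
theorem isUniversal_errorSentence {ψ : Language.pv.Formula (Fin (k + 1))} (hψ : ψ.IsQF) :
    (errorSentence ψ).IsUniversal :=
  ((isQF_errorFormula hψ).relabel _).isUniversal_alls

variable [hB : M ⊨ BASIC]

/-- The characteristic symbol of an open `ψ` is `1` where `ψ` holds and `0` where it fails, in a
model of `PV₁`. [cite: Krajicek1995, §5.3] -/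
theorem papp_charSymFin (hM : M ⊨ PV1) {ψ : Language.pv.Formula (Fin (k + 1))} (hψ : ψ.IsQF)
    (v : Fin (k + 1) → M) :
    (papp (charSymFin ψ) v ≠ 0 ↔ ψ.Realize v) := by
  have hD := model_PVdef_of_model_PV1 hM
  have e : papp (charSymFin ψ) v = (charTerm ψ).realize (Sum.elim v default) := by
    rw [charSymFin, papp_termSym hD, Term.realize_relabel]
    congr 1; funext a; rcases a with a | j
    · rfl
    · exact Fin.elim0 j
  rw [e]
  have h := realize_charTerm hM hψ v (default : Fin 0 → M)
  constructor
  · intro hne; exact h.1.1 (h.2.resolve_left hne)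
  · intro hψ' h0; exact zero_ne_one (h0.symm.trans (h.1.2 hψ'))

omit hB in
/-- Realizing the counterexample term. [folklore] -/
theorem realize_cexTerm (ψ : Language.pv.Formula (Fin (k + 1))) (v : Fin (k + 1) → M) :
    (cexTerm ψ).realize v = papp (PVFun.cex (charSymFin ψ)) v := by
  rw [cexTerm, Term.realize]; rfl

/-- **The error formula holds in every model of `PV₁`** (from `cex_spec`). [cite: Krajicek1995, §5.3] -/
theorem realize_errorFormula (hM : M ⊨ PV1) {ψ : Language.pv.Formula (Fin (k + 1))}
    (hψ : ψ.IsQF) (v : Fin (k + 1) → M) : (errorFormula ψ).Realize v := by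
  have hD := model_PVdef_of_model_PV1 hM
  have hv : v = Fin.snoc (Fin.init v) (v (Fin.last k)) := (Fin.snoc_init_self v).symm
  have hspec := cex_spec hM (charSymFin ψ) (Fin.init v) (v (Fin.last k))
  rw [← hv] at hspec
  have hup : ∀ t : M, Function.update v (Fin.last k) t = Fin.snoc (Fin.init v) t := by
    intro t; rw [hv, Fin.update_snoc_last, Fin.init_snoc]
  simp only [errorFormula, Formula.realize_inf, Formula.realize_imp, Formula.realize_not,
    Formula.realize_equal, realize_substLast, realize_cexTerm, realize_pvHalf', realize_pv_zero',
    mZero_eq, hup]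
  refine ⟨fun hC => ?_, fun hC h0 => ?_⟩
  · obtain ⟨h1, h2⟩ := hspec.1 hC
    refine ⟨fun hψC => ?_, (papp_charSymFin hM hψ _).1 h2⟩
    exact ((papp_charSymFin hM hψ _).2 hψC) h1
  · have h0' : papp (charSymFin ψ) (Fin.snoc (Fin.init v) 0) ≠ 0 :=
      (papp_charSymFin hM hψ _).2 h0
    have := hspec.2 hC h0'
    exact (papp_charSymFin hM hψ _).1 this

/-- **The error sentence of an open formula is true in every model of `PV₁`.**
[cite: Krajicek1995, §5.3] -/
theorem realize_errorSentence (hM : M ⊨ PV1) {ψ : Language.pv.Formula (Fin (k + 1))}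
    (hψ : ψ.IsQF) : M ⊨ errorSentence ψ :=
  (realize_closeFin _).2 fun v => realize_errorFormula hM hψ v

omit hB in
/-- **From the error sentence to `PIND`**: a structure satisfying `errorSentence ψ` satisfies the
`PIND` axiom of `ψ`. [cite: Krajicek1995, §5.3] -/
theorem realize_pvPindAxiom_of_errorSentence
    {ψ : Language.pv.Formula (Fin (k + 1))} (h : M ⊨ errorSentence ψ) : M ⊨ pvPindAxiom ψ := by
  rw [realize_pvPindAxiom_iff]
  intro p h0 hs a
  by_contra ha
  have hv := (realize_closeFin _).1 h (Fin.snoc p a)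
  have hup : ∀ t : M, Function.update (Fin.snoc p a : Fin (k + 1) → M) (Fin.last k) t =
      Fin.snoc p t := fun t => Fin.update_snoc_last _ _ _
  simp only [errorFormula, Formula.realize_inf, Formula.realize_imp, Formula.realize_not,
    Formula.realize_equal, realize_substLast, realize_cexTerm, realize_pvHalf', realize_pv_zero',
    hup] at hv
  obtain ⟨h1, h2⟩ := hv
  by_cases hC : papp (PVFun.cex (charSymFin ψ)) (Fin.snoc p a) = mZero M
  · exact ha (h2 hC h0)
  · obtain ⟨hnot, hhalf⟩ := h1 hC
    exact hnot (hs _ hhalf)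

end ErrorSentence

end PV1

/-! ## The universal theory of `PV₁` and Herbrand-saturated models of `PV₁` -/

section Univ

variable {M : Type} [Language.pv.Structure M]

/-- **The universal consequences of `PV₁`**: all universal `L(PV)`-sentences provable in
(semantically: true in all models of) `PV₁` (Krajíček 1995, §5.3: `PV₁` is a universal theory up
to logical equivalence). [cite: Krajicek1995, §5.3] -/
def univPV1 : Language.pv.Theory :=
  {σ | BoundedFormula.IsUniversal σ ∧ PV1 ⊨ᵇ σ}

/-- `univPV1` is a universal theory. [folklore] -/
instance isUniversal_univPV1 : (univPV1).IsUniversal := ⟨fun _ h => h.1⟩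

/-- Every `L(PV)`-structure is nonempty (it interprets `0`). [folklore] -/
theorem nonempty_of_pvStructure (M : Type) [Language.pv.Structure M] : Nonempty M :=
  ⟨Structure.funMap (L := Language.pv) PVFun.zero default⟩

/-- **Soundness**: a model of `PV₁` is a model of `univPV1`. [folklore] -/
theorem model_univPV1_of_model_PV1 (hM : M ⊨ PV1) : M ⊨ univPV1 := by
  haveI := hM
  haveI := nonempty_of_pvStructure M
  exact ⟨fun σ h => h.2.realize_sentence M⟩

/-- A sentence true in all models of `PV₁` (in `Type`) is a semantic consequence of `PV₁`.
[folklore] -/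
theorem PV1_models_of_forall {σ : Language.pv.Sentence}
    (h : ∀ (N : Type) [Language.pv.Structure N], N ⊨ PV1 → N ⊨ σ) : PV1 ⊨ᵇ σ := by
  rw [Theory.models_sentence_iff]
  intro N
  exact h N N.is_model

/-- The composition, projection and recursion axioms are universal sentences. [folklore] -/
private theorem isUniversal_closeFin {n : ℕ} {φ : Language.pv.Formula (Fin n)} (hφ : φ.IsQF) :
    (closeFin φ).IsUniversal :=
  (hφ.relabel _).isUniversal_alls

/-- `minFormula f a c` is open. [folklore] -/
private theorem isQF_minFormula {α : Type} {l : ℕ} (f a c : Language.pv.Term (α ⊕ Fin l)) :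
    (minFormula f a c).IsQF :=
  ((IsAtomic.rel _ _).isQF.imp (IsAtomic.equal _ _).isQF).inf
    (((IsAtomic.rel _ _).isQF.not).imp (IsAtomic.equal _ _).isQF)

/-- **Every axiom of `PVdef` is a universal sentence.** [cite: Cook1975, §2] -/
theorem isUniversal_of_mem_PVdef {σ : Language.pv.Sentence} (hσ : σ ∈ PVdef) :
    σ.IsUniversal := by
  simp only [PVdef, Set.mem_union, Set.mem_setOf_eq, Set.mem_iUnion, Set.mem_range,
    Prod.exists] at hσ
  rcases hσ with (((hσ | ⟨n, i, rfl⟩) | ⟨n, m, f, g, rfl⟩) | ⟨n, g, h, k, rfl⟩) |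
    ⟨n, b, g, h, k, rfl⟩
  · have key : ∀ ψ ∈ initialAxioms, BoundedFormula.IsUniversal ψ := by
      simp only [initialAxioms, List.forall_mem_cons]
      and_intros
      all_goals
        first
          | (intro x hx; simp at hx)
          | (refine BoundedFormula.IsQF.isUniversal_alls ?_
             repeat'
               first
                 | exact IsQF.falsum
                 | exact (IsAtomic.equal _ _).isQF
                 | exact (IsAtomic.rel _ _).isQF
                 | refine IsQF.imp ?_ ?_)
    exact key σ hσ
  · exact isUniversal_closeFin (IsAtomic.equal _ _).isQF
  · exact isUniversal_closeFin (IsAtomic.equal _ _).isQF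
  · exact isUniversal_closeFin (isQF_minFormula _ _ _)
  · exact isUniversal_closeFin (((IsAtomic.equal _ _).isQF.not).imp (isQF_minFormula _ _ _))

/-- `PVdef ⊆ univPV1`. [folklore] -/
theorem PVdef_subset_univPV1 : PVdef ⊆ univPV1 := fun _ hσ =>
  ⟨isUniversal_of_mem_PVdef hσ, Theory.models_sentence_of_mem (PVdef_subset_PV1 hσ)⟩

/-- Translated `BASIC ⊆ univPV1`. [folklore] -/
theorem onTheory_BASIC_subset_univPV1 : boundedArithToPV.onTheory BASIC ⊆ univPV1 := by
  rintro _ ⟨σ, hσ, rfl⟩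
  refine ⟨(isUniversal_of_mem_BASIC hσ).onBoundedFormula _, Theory.models_sentence_of_mem ?_⟩
  exact Set.subset_union_right.trans Set.subset_union_left ⟨σ, hσ, rfl⟩

/-- The error sentences of open formulas belong to `univPV1`. [cite: Krajicek1995, §5.3] -/
theorem errorSentence_mem_univPV1 {k : ℕ} {ψ : Language.pv.Formula (Fin (k + 1))}
    (hψ : ψ.IsQF) : PV1.errorSentence ψ ∈ univPV1 := by
  refine ⟨PV1.isUniversal_errorSentence hψ, PV1_models_of_forall fun N _ hN => ?_⟩
  haveI := model_BASIC_of_model_PV1 hN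
  exact PV1.realize_errorSentence hN hψ

/-- **A model of the universal theory of `PV₁` is a model of `PV₁`**: `PVdef` and `BASIC` are
universal, and every open `PIND` axiom follows from the corresponding error sentence
(Krajíček 1995, §5.3). [cite: Krajicek1995, §5.3] -/
theorem model_PV1_of_model_univPV1 (hK : M ⊨ univPV1) : M ⊨ PV1 := by
  have hD : M ⊨ PVdef := hK.mono PVdef_subset_univPV1
  have hB' : M ⊨ boundedArithToPV.onTheory BASIC := hK.mono onTheory_BASIC_subset_univPV1
  haveI : M ⊨ BASIC := (model_onTheory_boundedArithToPV_iff' BASIC).1 hB'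
  refine (hD.union hB').union ⟨fun σ hσ => ?_⟩
  simp only [Set.mem_iUnion, Set.mem_image] at hσ
  obtain ⟨k, ψ, hψ, rfl⟩ := hσ
  exact PV1.realize_pvPindAxiom_of_errorSentence
    (hK.realize_of_mem _ (errorSentence_mem_univPV1 hψ))

/-- **Herbrand-saturated models of `PV₁` over any model of `PV₁`.** Every model `M` of `PV₁`
maps into an Herbrand-saturated model `K` of `PV₁` by a map preserving all universal formulas
with parameters from `M` (Avigad 2002, Thm. 3.2, applied to the universal theory `univPV1`;
then `K ⊨ PV₁` by `model_PV1_of_model_univPV1`). [cite: Avigad2002, Theorem 3.2] -/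
theorem exists_herbrandSaturated_model_PV1 (M : Type) [Language.pv.Structure M] (hM : M ⊨ PV1) :
    ∃ (K : Type) (_ : Language.pv.Structure K) (f : M → K),
      K ⊨ PV1 ∧ IsHerbrandSaturated Language.pv K ∧ PreservesUniversal Language.pv f := by
  haveI := nonempty_of_pvStructure M
  haveI : M ⊨ univPV1 := model_univPV1_of_model_PV1 hM
  obtain ⟨K, _, _, f, hf, hK⟩ :=
    exists_preservesUniversal_isHerbrandSaturated (L := Language.pv) M
  have hKU : K ⊨ univPV1 := hf.model_of_isUniversal univPV1
  exact ⟨K, inferInstance, f, model_PV1_of_model_univPV1 hKU, hK, hf⟩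

end Univ

end Literature.Analysis.FunctionSpaces
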